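import Summits.Ventures.HSemireg.CechCupOneAnticomm
import Summits.Ventures.HSemireg.UntwistAtiyahStepWedge
import Summits.Ventures.HSemireg.UntwistCocycleTwistAtiyah
import Literature.AlgebraicGeometry.Motives.HodgeSheavesFree
import HarnessLib

/-!
# Venture HSemireg — route R1.0, rows `q ≥ 2`: the Atiyah steps commute with scalar `1`-form classes
# (th-4; input (L5) "centrality" of `general-structure/LEIBNIZ-ROW2-PLAN-gs-g4.md`, class level)

HONEST FRAMING. Module-level homological algebra on the tree's REAL carriers: Mathlib's `Abelian.Ext` in
`X.Modules`, the classes `at_j(E) = atiyahClassStep E j ∈ Ext¹(E ⊗ Ωʲ, E ⊗ Ωʲ⁺¹)` of the `Ωʲ`-twisted jet sequences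
(`HodgeTheory/SemiregularityHigherSigma`) as Čech classes of a bi-framing (`HodgeTheory/AtiyahClassStepCech`), the
cochain anticommutation of the sibling file `UntwistAtiyahStepWedge` and the cup-one homotopy of
`CechCupOneAnticomm`. Nothing about any variety; no twist functor appears in the statements (the scalar cocycle `θ`
is arbitrary; in the Leibniz application it is `dlog g`); nothing here says HC, HC_CM or HC_AV is proved.

WHAT IS PROVED (`namespace Summit.Ventures.HSemireg.AtiyahStepCommute`).

* `restrictHom_postcompOver`, `postcompOver_add` — restriction / additivity of gs-g4's local post-composition
  `CocycleTwist.postcompOver` (`UntwistCocycleTwistAtiyah`);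
* the **wedge family** `φ ↦ φ ≫ (θ_{xy} ∧ –) : (E ⊗ Ωʲ)| → (E ⊗ Ωʲ⁺¹)|` of a scalar Čech `1`-cochain of `1`-forms
  `θ = (θ_{xy} ∈ Γ(Ω¹, U_x ∩ U_y))` on a cover `U`, written INLINE as
  `fun β => CocycleTwist.postcompOver (dual E) (wedgeForm j (θ β))` (values `appLE_postcompOver_wedgeForm`), is a
  cocycle when `θ` is: `dFamily_postcompOver_wedgeForm` (hypothesis `θ_{xz}| = θ_{xy}| + θ_{yz}|` on triple overlaps);
* `atiyahClassStep_comp_wedgeClass` — **MAIN**: for a framing `𝔢` of `E` covering `X`, coframes `w`, `w'` of `Ωʲ`,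
  `Ωʲ⁺¹` over an open `Y` containing the cover, and a scalar Čech `1`-cocycle of `1`-forms `θ` on the cover with
  wedge classes `η_j = [φ ↦ φ ≫ (θ_{xy} ∧ –)] ∈ Ext¹(E ⊗ Ωʲ, E ⊗ Ωʲ⁺¹)` (over `Cech.exactAugmentation 𝔢.U`):
  **`η_j · at_{j+1}(E) = at_j(E) · η_{j+1}` in `Ext²(E ⊗ Ωʲ, E ⊗ Ωʲ⁺²)`** (Mathlib `Ext.comp` order) — the case
  `u = 1 ⊗ c`, `c = [θ] ∈ H¹(Ω¹)`, of the naturality / graded centrality of the Atiyah classes (Buchweitz–Flenner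
  Prop. 3.11 / (2.11.4); Prop. 3.12 for `Ext^•(𝓕, 𝓕)`), which Buchweitz–Flenner do not print in this form (their
  algebra `A = ⊕ Ext^i(𝓕, 𝓕 ⊗ Λ^j 𝕃)` is "associative but in general not graded commutative", §4) and which is
  PROVED HERE: `at_j = classOf (atiyahStepCocycle)` for the common-coframe bi-framings `BiFraming.ofFraming 𝔢 w hU`,
  `BiFraming.ofFraming 𝔢 w' hU` (`atiyahClassStep_eq_classOf_exactAugmentation`), hypothesis `H` of
  `Cech.comp_classOf_eq_of_anticomm` = `atiyahStepCocycle_comp_wedgeForm`. This is the commutation the row-`q`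
  re-expansion of `σ_q` uses (th-4 #8 `UntwistSigmaMultiplier`: hypothesis `Commute (θ a) c`; gs-g4 plan §5: "ν′'s
  are central");
* `atiyahClassStep_comp_wedgeClass_of_cotangentSheaf_free` — **the `Ω¹`-free branch** (`Ω¹_{X/S} ≅ 𝒪^I`, `I`
  finite; e.g. abelian schemes): the coframes over `X` come from `Motives.HodgeSheavesFree`, so only the framing of `E`
  and the cocycle `θ` remain as hypotheses. (The sibling `UntwistAtiyahStepCommuteLocFree` removes the common-coframe
  hypothesis altogether: arbitrary coframes on the opens, the anticommutation defect being a coboundary.)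

Which Ext groups: `Ext¹(E⊗Ωʲ, E⊗Ωʲ⁺¹) ∋ at_j, η_j`, `Ext²(E⊗Ωʲ, E⊗Ωʲ⁺²)` for the identity; which class: `at_j` and
the scalar class `[θ]`; which twist: none here (`θ = dlog g` in the sequel).

## References

* R.-O. Buchweitz, H. Flenner, Compositio Math. 137 (2003), §3 Def. 3.4 / Thm. 3.10 (Atiyah classes and powers),
  Prop. 3.11 / (2.11.4) (naturality), Prop. 3.12 (graded centrality of `At^k` w.r.t. `Ext^•(𝓕, 𝓕)`; arXiv
  math/9912245 p. 18), §4 (the algebra `A`, "associative but in general not graded commutative").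
  [BuchweitzFlenner2003]
* R. Hartshorne, *Algebraic Geometry* (1977), II.5 (sheaf Hom), II Ex. 5.16, III.4 (Čech cohomology). [Hartshorne1977]
-/

set_option backward.isDefEq.respectTransparency false

noncomputable section

universe u

open CategoryTheory CategoryTheory.Abelian AlgebraicGeometry Opposite TopologicalSpace Limits

namespace Summit.Ventures.HSemireg

namespace AtiyahStepCommute

open Literature.AlgebraicGeometry.Modules Literature.AlgebraicGeometry.Motives
  Literature.AlgebraicGeometry.HodgeTheory Literature.AlgebraicGeometry.Modules.Cech

variable {S : Type u} [CommRing S] {X : Over (Spec (CommRingCat.of S))} (E : X.left.Modules) (j : ℕ)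
  {V : X.left.Opens} {K K' : Type u}

/-! ### The Atiyah steps commute with scalar `1`-form classes -/

section Classes

/-- gs-g4's local post-composition `CocycleTwist.postcompOver` (`UntwistCocycleTwistAtiyah`) commutes with
restriction. [folklore] -/
lemma restrictHom_postcompOver {A M N : X.left.Modules} {U : X.left.Opens} (f : M.over U ⟶ N.over U) (k : V ⟶ U) :
    restrictHom k (CocycleTwist.postcompOver A f) = CocycleTwist.postcompOver A (restrictHom k f) :=
  hom_ext_of_appLE fun W' l φ => by
    rw [appLE_restrictHom]
    change (φ : A.over W' ⟶ M.over W') ≫ restrictHom (l ≫ k) f = (φ : A.over W' ⟶ M.over W') ≫ restrictHom l (restrictHom k f)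
    rw [restrictHom_comp']

/-- `CocycleTwist.postcompOver` is additive. [folklore] -/
lemma postcompOver_add {A M N : X.left.Modules} {U : X.left.Opens} (f g : M.over U ⟶ N.over U) :
    CocycleTwist.postcompOver A (f + g) = CocycleTwist.postcompOver A f + CocycleTwist.postcompOver A g :=
  hom_ext_of_appLE fun W' l φ => by
    rw [appLE_add]
    change (φ : A.over W' ⟶ M.over W') ≫ restrictHom l (f + g) =
      (φ : A.over W' ⟶ M.over W') ≫ restrictHom l f + (φ : A.over W' ⟶ M.over W') ≫ restrictHom l g
    rw [restrictHom_add, Preadditive.comp_add]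

variable {ι : Type u} {U : ι → X.left.Opens}

variable {E j}

/-- Values of the **wedge cochain** `φ ↦ φ ≫ (θ ∧ –)` (gs-g4's local post-composition with `wedgeForm j θ`):
`φ ↦ φ ≫ (θ|_V ∧ –)`. [folklore] -/
lemma appLE_postcompOver_wedgeForm {U' : X.left.Opens} (θ : Γ(cotangentSheaf X, U')) (k : V ⟶ U')
    (φ : Γ(twistHodge E j, V)) :
    appLE (CocycleTwist.postcompOver (dual E) (wedgeForm j θ)) k φ =
      (((φ : (dual E).over V ⟶ (hodgeSheaf X j).over V) ≫
          wedgeForm j ((cotangentSheaf X).presheaf.map k.op θ) :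
        (dual E).over V ⟶ (hodgeSheaf X (j + 1)).over V) : Γ(twistHodge E (j + 1), V)) := by
  rw [← restrictHom_wedgeForm]
  rfl

/-- **The wedge family `φ ↦ φ ≫ (θ_{xy} ∧ –)` of a scalar Čech `1`-cocycle of `1`-forms `θ = (θ_{xy})` on the
cover (`θ_{xz}| = θ_{xy}| + θ_{yz}|` on triple overlaps) is a Čech `1`-cocycle of local homomorphisms
`E ⊗ Ωʲ → E ⊗ Ωʲ⁺¹`.** [cite: BuchweitzFlenner2003, §4] -/
theorem dFamily_postcompOver_wedgeForm (θ : ∀ β : Fin 2 → ι, Γ(cotangentSheaf X, face U β))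
    (hθ : ∀ τ : Fin 3 → ι,
      (cotangentSheaf X).presheaf.map (homOfLE (face_le_face_comp U τ (Fin.succAbove 1))).op (θ (τ ∘ Fin.succAbove 1)) =
        (cotangentSheaf X).presheaf.map (homOfLE (face_le_face_comp U τ (Fin.succAbove 0))).op (θ (τ ∘ Fin.succAbove 0)) +
          (cotangentSheaf X).presheaf.map (homOfLE (face_le_face_comp U τ (Fin.succAbove 2))).op
            (θ (τ ∘ Fin.succAbove 2))) :
    dFamily (fun β => CocycleTwist.postcompOver (dual E) (wedgeForm j (θ β)) :
        LocalFamily U 1 (twistHodge E j) (twistHodge E (j + 1))) = 0 := by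
  funext τ
  rw [dFamily, Fin.sum_univ_three, Pi.zero_apply]
  simp only [Fin.val_zero, pow_zero, one_smul, Fin.val_one, pow_one, neg_one_zsmul, Fin.val_two, neg_one_sq,
    restrictHom_postcompOver, restrictHom_wedgeForm]
  rw [hθ τ, wedgeForm_add, postcompOver_add]
  abel

variable [HasExt.{u + 1} X.left.Modules]

/-- **The Atiyah steps commute with scalar `1`-form classes.** For a framing `𝔢` of `E` covering `X`, common
coframes `w`, `w'` of `Ωʲ`, `Ωʲ⁺¹` over an open `Y` containing the cover, and a scalar Čech `1`-cocycle of
`1`-forms `θ = (θ_{xy})` on the cover with wedge classes `η_j = [φ ↦ φ ≫ (θ_{xy} ∧ –)] ∈ Ext¹(E ⊗ Ωʲ, E ⊗ Ωʲ⁺¹)`: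
`η_j · at_{j+1}(E) = at_j(E) · η_{j+1}` in `Ext²(E ⊗ Ωʲ, E ⊗ Ωʲ⁺²)` (Yoneda composites, Mathlib `Ext.comp` order):
the `1 ⊗ c` case (`c = [θ]`) of the naturality / graded centrality of the Atiyah classes (Buchweitz–Flenner
Prop. 3.11, (2.11.4); Prop. 3.12 for `Ext^•(𝓕, 𝓕)`) — derived, not printed there; proved here on cochains from
`atiyahStepCocycle_comp_wedgeForm` and the cup-one homotopy `Cech.comp_classOf_eq_of_anticomm`.
[cite: BuchweitzFlenner2003, Prop. 3.12] -/
theorem atiyahClassStep_comp_wedgeClass (𝔢 : Framing E ι) (hcov : iSup 𝔢.U = ⊤) {Y : X.left.Opens}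
    [Fintype K] [Fintype K'] (w : SheafOfModules.free K ≅ (hodgeSheaf X j).over Y)
    (w' : SheafOfModules.free K' ≅ (hodgeSheaf X (j + 1)).over Y) (hU : ∀ a, 𝔢.U a ≤ Y)
    (θ : ∀ β : Fin 2 → ι, Γ(cotangentSheaf X, face 𝔢.U β))
    (hθ : ∀ τ : Fin 3 → ι,
      (cotangentSheaf X).presheaf.map (homOfLE (face_le_face_comp 𝔢.U τ (Fin.succAbove 1))).op
          (θ (τ ∘ Fin.succAbove 1)) =
        (cotangentSheaf X).presheaf.map (homOfLE (face_le_face_comp 𝔢.U τ (Fin.succAbove 0))).op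
            (θ (τ ∘ Fin.succAbove 0)) +
          (cotangentSheaf X).presheaf.map (homOfLE (face_le_face_comp 𝔢.U τ (Fin.succAbove 2))).op
            (θ (τ ∘ Fin.succAbove 2))) :
    (Cech.classOf (Cech.exactAugmentation 𝔢.U (twistHodge E (j + 1)) hcov)
        (fun β => CocycleTwist.postcompOver (dual E) (wedgeForm j (θ β)) :
          LocalFamily 𝔢.U 1 (twistHodge E j) (twistHodge E (j + 1)))
        (dFamily_postcompOver_wedgeForm θ hθ)).comp (atiyahClassStep E (j + 1)) rfl =
      (atiyahClassStep E j).comp (Cech.classOf (Cech.exactAugmentation 𝔢.U (twistHodge E (j + 1 + 1)) hcov)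
        (fun β => CocycleTwist.postcompOver (dual E) (wedgeForm (j + 1) (θ β)) :
          LocalFamily 𝔢.U 1 (twistHodge E (j + 1)) (twistHodge E (j + 1 + 1)))
        (dFamily_postcompOver_wedgeForm θ hθ)) rfl := by
  rw [atiyahClassStep_eq_classOf_exactAugmentation E (j + 1) (BiFraming.ofFraming 𝔢 w' hU) hcov,
    atiyahClassStep_eq_classOf_exactAugmentation E j (BiFraming.ofFraming 𝔢 w hU) hcov]
  refine Cech.comp_classOf_eq_of_anticomm (U := 𝔢.U) (atiyahStepCocycle E j (BiFraming.ofFraming 𝔢 w hU))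
    (fun β => CocycleTwist.postcompOver (dual E) (wedgeForm (j + 1) (θ β)))
    (fun β => CocycleTwist.postcompOver (dual E) (wedgeForm j (θ β)))
    (atiyahStepCocycle E (j + 1) (BiFraming.ofFraming 𝔢 w' hU))
    _ _ _ (Cech.exactAugmentation_ε _ _ hcov) (Cech.exactAugmentation_ε _ _ hcov) _ _ _ _ fun τ W k x => ?_
  rw [appLE_postcompOver_wedgeForm, appLE_postcompOver_wedgeForm]
  exact atiyahStepCocycle_comp_wedgeForm w w' 𝔢 hU (back 1 τ) _ x _

/-- **The `Ω¹`-free branch** (e.g. `X` an abelian scheme, `Ω¹_{X/S} ≅ 𝒪^g` on the invariant differentials): when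
the cotangent sheaf is globally free of finite rank, the coframes of `Ωʲ`, `Ωʲ⁺¹` over `X` exist
(`Motives.nonempty_hodgeSheaf_iso_free_of_equiv`), so for EVERY framing of `E` covering `X` and every scalar Čech
`1`-cocycle of `1`-forms `θ` on it, `η_j · at_{j+1}(E) = at_j(E) · η_{j+1}`. [cite: BuchweitzFlenner2003, §4] -/
theorem atiyahClassStep_comp_wedgeClass_of_cotangentSheaf_free {I₁ : Type u} [Finite I₁]
    (hΩ : Nonempty (cotangentSheaf X ≅ SheafOfModules.free I₁)) (𝔢 : Framing E ι) (hcov : iSup 𝔢.U = ⊤)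
    (θ : ∀ β : Fin 2 → ι, Γ(cotangentSheaf X, face 𝔢.U β))
    (hθ : ∀ τ : Fin 3 → ι,
      (cotangentSheaf X).presheaf.map (homOfLE (face_le_face_comp 𝔢.U τ (Fin.succAbove 1))).op
          (θ (τ ∘ Fin.succAbove 1)) =
        (cotangentSheaf X).presheaf.map (homOfLE (face_le_face_comp 𝔢.U τ (Fin.succAbove 0))).op
            (θ (τ ∘ Fin.succAbove 0)) +
          (cotangentSheaf X).presheaf.map (homOfLE (face_le_face_comp 𝔢.U τ (Fin.succAbove 2))).op
            (θ (τ ∘ Fin.succAbove 2))) :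
    (Cech.classOf (Cech.exactAugmentation 𝔢.U (twistHodge E (j + 1)) hcov)
        (fun β => CocycleTwist.postcompOver (dual E) (wedgeForm j (θ β)) :
          LocalFamily 𝔢.U 1 (twistHodge E j) (twistHodge E (j + 1)))
        (dFamily_postcompOver_wedgeForm θ hθ)).comp (atiyahClassStep E (j + 1)) rfl =
      (atiyahClassStep E j).comp (Cech.classOf (Cech.exactAugmentation 𝔢.U (twistHodge E (j + 1 + 1)) hcov)
        (fun β => CocycleTwist.postcompOver (dual E) (wedgeForm (j + 1) (θ β)) :
          LocalFamily 𝔢.U 1 (twistHodge E (j + 1)) (twistHodge E (j + 1 + 1)))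
        (dFamily_postcompOver_wedgeForm θ hθ)) rfl := by
  obtain ⟨e⟩ := hΩ
  obtain ⟨f⟩ := nonempty_hodgeSheaf_iso_free_of_equiv X e j (Equiv.refl _)
  obtain ⟨f'⟩ := nonempty_hodgeSheaf_iso_free_of_equiv X e (j + 1) (Equiv.refl _)
  obtain ⟨w⟩ := nonempty_free_iso_over_of_iso_free f ⊤
  obtain ⟨w'⟩ := nonempty_free_iso_over_of_iso_free f' ⊤
  haveI : Fintype (Set.powersetCard I₁ j) := Fintype.ofFinite _
  haveI : Fintype (Set.powersetCard I₁ (j + 1)) := Fintype.ofFinite _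
  exact atiyahClassStep_comp_wedgeClass 𝔢 hcov w w' (fun _ => le_top) θ hθ

end Classes

end AtiyahStepCommute

end Summit.Ventures.HSemireg

end
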